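import Mathlib
import HarnessLib
import Literature.MathematicalPhysics.KineticTheory.HardSphereEulerProofs
import Literature.MathematicalPhysics.KineticTheory.HardSphereTwoTimePressure
import Summits.AtomisticToContinuum.HydrodynamicLimit.Theses.OneFlightGossipEngine
import Summits.AtomisticToContinuum.HydrodynamicLimit.Theorems.OneFlightGossipEngineKineticCurrentsWindowLDApriori
import Summits.AtomisticToContinuum.HydrodynamicLimit.Theorems.OneFlightGossipEngineKineticCurrentsWindowLDSplit
import Summits.AtomisticToContinuum.HydrodynamicLimit.Theorems.OneFlightGossipEngineEquilibriumStressVarianceDecayWindows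
import Summits.AtomisticToContinuum.HydrodynamicLimit.Theorems.OneFlightGossipEngineKineticCurrentsLDAlongFamiliesWindowRenyiOfTransport
import Summits.AtomisticToContinuum.HydrodynamicLimit.Theorems.OneFlightGossipEngineKineticCurrentsWindowLDUniformWindowRenyiOfTransportPrelim

/-! # Mover census — stub `stub_moverCensus` (S7) of line `Sketch`, crux `LocalClampedTransferLDAlongFamilies`
# (stmt-AtomisticToContinuum-17691)

Route `OneFlightGossipEngine`, card `shrinking-window-cell-transfer`. Because the kinetic window
`w = τ(N+1)^{-1/3}` shrinks with `N`, at every large-deviation scale `e^{O(N)}` only `o(N)` particles travel a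
macroscopic distance `d` during the window: a *mover* is a particle whose window path length
`∫₀ʷ ‖vᵢ(r)‖ dr` reaches `d`. We prove the registered Prop `MoverCensus`: along any jointly continuous
positive profile family `s ↦ (a s, θ₀ s, u₀ s)` on `[0, t₁] × 𝕋³`, for `d > 0`, `lam ≥ 0`, `δ > 0` and
`N ≥ N₀`, `∫ exp(lam · #movers) dλ^N_s ≤ e^{δ(N+1)}` uniformly in `s ∈ [0, t₁]`.

Proof (elementary statics + energy conservation).
(i) Cauchy–Schwarz in time along a good orbit, `(∫₀ʷ‖vᵢ‖)² ≤ w ∫₀ʷ‖vᵢ‖²`, so the mover indicator is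
`≤ (w/d²) ∫₀ʷ ‖vᵢ(r)‖² dr`; summing and using `∑ᵢ ∫₀ʷ‖vᵢ‖² = 2E(z)·w` (energy conservation on the good set)
gives `#movers ≤ (2w²/d²) E(z)`, i.e. `lam · #movers ≤ γ_N E(z)` with `γ_N = 2 lam w²/d² → 0`.
(ii) Gaussian fibres of the local Gibbs law: `∫ e^{γE} dλ^N ≤ (e^{γU²}(1-2γΘ)^{-3/2})^{N+1}` with the family
bounds `θ₀ ≤ Θ`, `‖u₀‖ ≤ U` on `[0,t₁] × 𝕋³`; for `δ > 0` a `γ⋆ > 0` makes the bracket `≤ e^δ`, and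
`γ_N ≤ γ⋆` for `N ≥ N₀` (monotonicity of the bracket in `γ`).
References: Olla–Varadhan–Yau, Comm. Math. Phys. 155 (1993) 523, §2–3; Spohn, *Large Scale Dynamics of
Interacting Particles* (1991), Part I §2.3. -/

noncomputable section

open MeasureTheory Set Filter
open scoped ENNReal Topology BigOperators

namespace Summit.AtomisticToContinuum.HydrodynamicLimit.Theorems.LocalClampedTransferSketch

open Literature.Analysis.FluidPDE (HardSphereFlow Config localMaxwellian canonicalDensity liouville
  hardSphereDomain configEnergy)
open Literature.MathematicalPhysics.KineticTheory (T3 V3 hsDiameter localGibbsLaw localGibbsMeasure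
  localGibbsProfile)
open Literature.Analysis.FluidPDE Literature.MathematicalPhysics.KineticTheory Literature.Analysis.FunctionSpaces
open Summit.AtomisticToContinuum.HydrodynamicLimit.Theorems.KineticCurrentsLDAlongFamiliesSketch
  (wrf_exists_forall_le_family)
open Summit.AtomisticToContinuum.HydrodynamicLimit.Theorems.KineticCurrentsWindowLDUniformLocalGibbs
  (wre_exists_gamma wre_exists_N0)

/-! ### The registered Prop -/

/-- registered stub signature S7 `stub_moverCensus` of line Sketch, crux LocalClampedTransferLDAlongFamilies
(stmt-AtomisticToContinuum-17691) — route-internal, not a cited fact. Along any jointly continuous positive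
profile family, for every macroscopic distance `d > 0`, multiplier `lam ≥ 0` and tolerance `δ > 0`, for
`N ≥ N₀` the number of particles whose window path length `∫₀ʷ ‖vᵢ(r)‖ dr` reaches `d` during the kinetic
window `w = τ(N+1)^{-1/3}` has exponential moment `≤ e^{δ(N+1)}` under the local Gibbs law `λ^N_s`,
uniformly in `s ∈ [0, t₁]`. -/
def MoverCensus : Prop :=
  ∀ (t₁ : ℝ) (a θ₀ : ℝ → T3 → ℝ) (u₀ : ℝ → T3 → V3),
    Continuous (Function.uncurry a) → Continuous (Function.uncurry θ₀) →
    Continuous (Function.uncurry u₀) → (∀ s x, 0 < a s x) → (∀ s x, 0 < θ₀ s x) →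
    ∀ σ : ℝ, 0 < σ → σ < 1 / 2 →
    ∀ Φ : (N : ℕ) → HardSphereFlow (Torus.geometry (Fin 3)) (hsDiameter σ N) (N + 1),
    ∀ (τ d lam δ : ℝ), 0 < τ → 0 < d → 0 ≤ lam → 0 < δ →
    ∃ N₀ : ℕ, ∀ N : ℕ, N₀ ≤ N → ∀ s ∈ Set.Icc 0 t₁,
      (let w : ℝ := τ * ((N : ℝ) + 1) ^ (-(1 / 3 : ℝ))
       let P := localGibbsLaw σ (a s) (u₀ s) (θ₀ s) N (Φ N)
       let movers := fun (z : Config (N + 1) (Fin 3) T3) =>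
         ∑ i : Fin (N + 1), (if d ≤ ∫ r in (0 : ℝ)..w, ‖((Φ N).flow r z i).2‖ then (1 : ℝ) else 0)
       ∫⁻ z, ENNReal.ofReal (Real.exp (lam * movers z)) ∂P ≤
         ENNReal.ofReal (Real.exp (δ * ((N : ℝ) + 1))))

/-! ### (i) Movers are few on every energy shell -/

/-- **One mover indicator is controlled by the window kinetic action.** For a good orbit, `w ≥ 0` and
`d > 0`: `1{d ≤ ∫₀ʷ ‖vᵢ‖} ≤ (w/d²) ∫₀ʷ ‖vᵢ(r)‖² dr` (Cauchy–Schwarz in time). -/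
theorem mover_indicator_le {ε : ℝ} {n : ℕ}
    (Φ : HardSphereFlow (Torus.geometry (Fin 3)) ε n) {z : Config n (Fin 3) T3} (hz : z ∈ Φ.good)
    {w d : ℝ} (hw : 0 ≤ w) (hd : 0 < d) (i : Fin n) :
    (if d ≤ ∫ r in (0 : ℝ)..w, ‖(Φ.flow r z i).2‖ then (1 : ℝ) else 0) ≤
      w / d ^ 2 * ∫ r in (0 : ℝ)..w, ‖(Φ.flow r z i).2‖ ^ 2 := by
  have hint1 : IntervalIntegrable (fun r => ‖(Φ.flow r z i).2‖) volume 0 w :=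
    intervalIntegrable_comp_orbit Φ hz (F := fun y => ‖y.2‖) continuous_snd.norm i 0 w
  have hint2 : IntervalIntegrable (fun r => ‖(Φ.flow r z i).2‖ ^ 2) volume 0 w :=
    (sum_window_integral_norm_sq_eq Φ hz w).1 i
  have hsq0 : 0 ≤ ∫ r in (0 : ℝ)..w, ‖(Φ.flow r z i).2‖ ^ 2 :=
    intervalIntegral.integral_nonneg hw fun r _ => sq_nonneg _
  by_cases h : d ≤ ∫ r in (0 : ℝ)..w, ‖(Φ.flow r z i).2‖
  · rw [if_pos h]
    have hcs := EquilibriumStressVarianceDecayC3.sq_integral_le_mul_integral_sq hw hint1 hint2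
    have hd2 : d ^ 2 ≤ w * ∫ r in (0 : ℝ)..w, ‖(Φ.flow r z i).2‖ ^ 2 :=
      (pow_le_pow_left₀ hd.le h 2).trans hcs
    rw [div_mul_eq_mul_div, le_div_iff₀ (pow_pos hd 2), one_mul]
    exact hd2
  · rw [if_neg h]
    exact mul_nonneg (div_nonneg hw (sq_nonneg _)) hsq0

/-- **Mover census on an energy shell.** For a good orbit, `w ≥ 0`, `d > 0`:
`#movers ≤ (2w²/d²) E(z)` (sum of `mover_indicator_le` and `∑ᵢ ∫₀ʷ‖vᵢ‖² = 2E(z)w`). -/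
theorem movers_le_energy {ε : ℝ} {n : ℕ}
    (Φ : HardSphereFlow (Torus.geometry (Fin 3)) ε n) {z : Config n (Fin 3) T3} (hz : z ∈ Φ.good)
    {w d : ℝ} (hw : 0 ≤ w) (hd : 0 < d) :
    (∑ i, (if d ≤ ∫ r in (0 : ℝ)..w, ‖(Φ.flow r z i).2‖ then (1 : ℝ) else 0)) ≤
      2 * w ^ 2 / d ^ 2 * configEnergy z := by
  have hsum := (sum_window_integral_norm_sq_eq Φ hz w).2
  calc (∑ i, (if d ≤ ∫ r in (0 : ℝ)..w, ‖(Φ.flow r z i).2‖ then (1 : ℝ) else 0))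
      ≤ ∑ i, w / d ^ 2 * ∫ r in (0 : ℝ)..w, ‖(Φ.flow r z i).2‖ ^ 2 :=
        Finset.sum_le_sum fun i _ => mover_indicator_le Φ hz hw hd i
    _ = w / d ^ 2 * (2 * configEnergy z * w) := by rw [← Finset.mul_sum, hsum]
    _ = 2 * w ^ 2 / d ^ 2 * configEnergy z := by ring

/-- **Exponential tilt of the census**: on the good set, `lam · #movers ≤ γ E(z)` with
`γ = lam/(2d²) · 4w²` (`= 2 lam w²/d²`). -/
theorem lam_mul_movers_le {ε : ℝ} {n : ℕ}
    (Φ : HardSphereFlow (Torus.geometry (Fin 3)) ε n) {z : Config n (Fin 3) T3} (hz : z ∈ Φ.good)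
    {w d lam : ℝ} (hw : 0 ≤ w) (hd : 0 < d) (hlam : 0 ≤ lam) :
    lam * (∑ i, (if d ≤ ∫ r in (0 : ℝ)..w, ‖(Φ.flow r z i).2‖ then (1 : ℝ) else 0)) ≤
      lam / (2 * d ^ 2) * (4 * w ^ 2) * configEnergy z := by
  calc lam * (∑ i, (if d ≤ ∫ r in (0 : ℝ)..w, ‖(Φ.flow r z i).2‖ then (1 : ℝ) else 0))
      ≤ lam * (2 * w ^ 2 / d ^ 2 * configEnergy z) :=
        mul_le_mul_of_nonneg_left (movers_le_energy Φ hz hw hd) hlam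
    _ = lam / (2 * d ^ 2) * (4 * w ^ 2) * configEnergy z := by
        field_simp
        ring

/-! ### (ii) Gaussian fibres: monotonicity of the one-particle bracket in `γ` -/

/-- The one-particle bracket `exp(γU²)(1-2γΘ)^{-3/2}` is monotone in `γ < 1/(2Θ)` (`Θ ≥ 0`). -/
theorem bracket_mono {γ γ' Θ U : ℝ} (hγγ' : γ ≤ γ') (hΘ : 0 ≤ Θ) (hγ'Θ : 2 * γ' * Θ < 1) :
    Real.exp (γ * U ^ 2) * (1 - 2 * γ * Θ) ^ (-(3 : ℝ) / 2) ≤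
      Real.exp (γ' * U ^ 2) * (1 - 2 * γ' * Θ) ^ (-(3 : ℝ) / 2) := by
  have hk' : 0 < 1 - 2 * γ' * Θ := by linarith
  have hle : 1 - 2 * γ' * Θ ≤ 1 - 2 * γ * Θ := by nlinarith
  refine mul_le_mul ?_ ?_ (Real.rpow_nonneg (hk'.le.trans hle) _) (Real.exp_nonneg _)
  · exact Real.exp_le_exp.2 (mul_le_mul_of_nonneg_right hγγ' (sq_nonneg U))
  · exact Real.rpow_le_rpow_of_nonpos hk' hle (by norm_num)

/-- **One window, one `N`, one profile.** Under `localGibbsLaw σ a₀ u₀ θ₀ N Φ` with `θ₀ ≤ Θ`, `‖u₀‖ ≤ U`,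
`σ ≤ 1/2`: if `0 ≤ lam`, `0 < d`, `0 < w` and `γ := lam/(2d²)·4w²` satisfies `2γΘ < 1`, then
`∫ exp(lam · #movers) dλ ≤ (exp(γU²)(1-2γΘ)^{-3/2})^{N+1}`. -/
theorem lintegral_exp_movers_le {a₀ θ₀ : T3 → ℝ} {u₀ : T3 → V3}
    (ha : Continuous a₀) (hθ : Continuous θ₀) (hu : Continuous u₀) (ha0 : ∀ x, 0 < a₀ x)
    (hθ0 : ∀ x, 0 < θ₀ x) {σ : ℝ} (hσ2 : σ ≤ 1 / 2) (N : ℕ)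
    (Φ : HardSphereFlow (Torus.geometry (Fin 3)) (hsDiameter σ N) (N + 1))
    {Θ U : ℝ} (hΘ : ∀ x, θ₀ x ≤ Θ) (hU : ∀ x, ‖u₀ x‖ ≤ U)
    {w d lam : ℝ} (hw : 0 < w) (hd : 0 < d) (hlam : 0 ≤ lam)
    (hγΘ : 2 * (lam / (2 * d ^ 2) * (4 * w ^ 2)) * Θ < 1) :
    ∫⁻ z, ENNReal.ofReal (Real.exp (lam *
        ∑ i : Fin (N + 1), (if d ≤ ∫ r in (0 : ℝ)..w, ‖(Φ.flow r z i).2‖ then (1 : ℝ) else 0)))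
        ∂(localGibbsLaw σ a₀ u₀ θ₀ N Φ) ≤
      ENNReal.ofReal ((Real.exp (lam / (2 * d ^ 2) * (4 * w ^ 2) * U ^ 2) *
        (1 - 2 * (lam / (2 * d ^ 2) * (4 * w ^ 2)) * Θ) ^ (-(3 : ℝ) / 2)) ^ (N + 1)) := by
  set γ : ℝ := lam / (2 * d ^ 2) * (4 * w ^ 2)
  have hγ0 : 0 ≤ γ := by positivity
  have hae : ∀ᵐ z ∂(localGibbsLaw σ a₀ u₀ θ₀ N Φ),
      ENNReal.ofReal (Real.exp (lam *
        ∑ i : Fin (N + 1), (if d ≤ ∫ r in (0 : ℝ)..w, ‖(Φ.flow r z i).2‖ then (1 : ℝ) else 0))) ≤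
        ENNReal.ofReal (Real.exp (γ * configEnergy z)) := by
    filter_upwards [ae_mem_good_localGibbsLaw σ a₀ u₀ θ₀ N Φ] with z hz
    exact ENNReal.ofReal_le_ofReal (Real.exp_le_exp.2 (lam_mul_movers_le Φ hz hw.le hd hlam))
  exact (lintegral_mono_ae hae).trans
    (lintegral_exp_mul_configEnergy_localGibbsLaw_le ha hθ hu ha0 hθ0 hσ2 N Φ hγ0 hΘ hU hγΘ)

/-! ### Assembly along the family -/

/-- **`MoverCensus`, spelled out** (the body of the registered Prop, usable without unfolding): along any
jointly continuous positive profile family on `[0, t₁] × 𝕋³`, for `0 < σ < 1/2`, every flow family,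
`τ, d > 0`, `lam ≥ 0`, `δ > 0` there is `N₀` with
`∫ exp(lam · #{i : ∫₀ʷ ‖vᵢ(r)‖ dr ≥ d}) dλ^N_s ≤ e^{δ(N+1)}` for all `N ≥ N₀`, `s ∈ [0, t₁]`,
`w = τ(N+1)^{-1/3}`. -/
theorem moverCensus_spelled :
    ∀ (t₁ : ℝ) (a θ₀ : ℝ → T3 → ℝ) (u₀ : ℝ → T3 → V3),
    Continuous (Function.uncurry a) → Continuous (Function.uncurry θ₀) →
    Continuous (Function.uncurry u₀) → (∀ s x, 0 < a s x) → (∀ s x, 0 < θ₀ s x) →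
    ∀ σ : ℝ, 0 < σ → σ < 1 / 2 →
    ∀ Φ : (N : ℕ) → HardSphereFlow (Torus.geometry (Fin 3)) (hsDiameter σ N) (N + 1),
    ∀ (τ d lam δ : ℝ), 0 < τ → 0 < d → 0 ≤ lam → 0 < δ →
    ∃ N₀ : ℕ, ∀ N : ℕ, N₀ ≤ N → ∀ s ∈ Set.Icc 0 t₁,
      (let w : ℝ := τ * ((N : ℝ) + 1) ^ (-(1 / 3 : ℝ))
       let P := localGibbsLaw σ (a s) (u₀ s) (θ₀ s) N (Φ N)
       let movers := fun (z : Config (N + 1) (Fin 3) T3) =>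
         ∑ i : Fin (N + 1), (if d ≤ ∫ r in (0 : ℝ)..w, ‖((Φ N).flow r z i).2‖ then (1 : ℝ) else 0)
       ∫⁻ z, ENNReal.ofReal (Real.exp (lam * movers z)) ∂P ≤
         ENNReal.ofReal (Real.exp (δ * ((N : ℝ) + 1)))) := by
  intro t₁ a θ₀ u₀ ha hθ hu ha0 hθ0 σ _hσ hσ2 Φ τ d lam δ hτ hd hlam hδ
  -- family bounds on the compact `[0, t₁] × 𝕋³`
  obtain ⟨Θ, hΘ0, hΘ⟩ := wrf_exists_forall_le_family hθ t₁
  have hun : Continuous (Function.uncurry fun s x => ‖u₀ s x‖) := hu.norm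
  obtain ⟨U, _hU0, hU⟩ := wrf_exists_forall_le_family hun t₁
  -- the Gaussian exponent for the tolerance `δ`, and the threshold `N₀`
  obtain ⟨γs, hγs0, hγsΘ, hγsδ⟩ := wre_exists_gamma hΘ0 hδ U
  obtain ⟨N₀, hN₀⟩ := wre_exists_N0 τ (lam / (2 * d ^ 2)) hγs0
  refine ⟨N₀, fun N hN s hs => ?_⟩
  dsimp only
  have hw : 0 < τ * ((N : ℝ) + 1) ^ (-(1 / 3 : ℝ)) :=
    mul_pos hτ (Real.rpow_pos_of_pos (by positivity) _)
  have hγN := hN₀ N hN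
  have hγNΘ : 2 * (lam / (2 * d ^ 2) * (4 * (τ * ((N : ℝ) + 1) ^ (-(1 / 3 : ℝ))) ^ 2)) * Θ < 1 := by
    nlinarith
  refine (lintegral_exp_movers_le (ha.uncurry_left s) (hθ.uncurry_left s) (hu.uncurry_left s)
    (ha0 s) (hθ0 s) hσ2.le N (Φ N) (hΘ s hs) (hU s hs) hw hd hlam hγNΘ).trans ?_
  refine ENNReal.ofReal_le_ofReal ?_
  have hK := (bracket_mono (U := U) hγN.le hΘ0.le hγsΘ).trans hγsδ
  have hK0 : 0 ≤ Real.exp (lam / (2 * d ^ 2) * (4 * (τ * ((N : ℝ) + 1) ^ (-(1 / 3 : ℝ))) ^ 2) * U ^ 2) *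
      (1 - 2 * (lam / (2 * d ^ 2) * (4 * (τ * ((N : ℝ) + 1) ^ (-(1 / 3 : ℝ))) ^ 2)) * Θ) ^
        (-(3 : ℝ) / 2) :=
    mul_nonneg (Real.exp_nonneg _) (Real.rpow_nonneg (by linarith) _)
  refine (pow_le_pow_left₀ hK0 hK (N + 1)).trans_eq ?_
  rw [← Real.exp_nat_mul]
  congr 1
  push_cast
  ring

/-- S7 — `MoverCensus` (Cauchy–Schwarz in time, energy conservation, Gaussian fibres). -/
theorem stub_moverCensus : MoverCensus :=
  moverCensus_spelled

end Summit.AtomisticToContinuum.HydrodynamicLimit.Theorems.LocalClampedTransferSketch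

end
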